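import Summits.ResolutionOfSingularities.ResolutionOfSingularities.Theorems.EquisingularLiftEquisingularLiftNatP1VBSubbundleTransfer
import Summits.ResolutionOfSingularities.ResolutionOfSingularities.Theorems.EquisingularLiftEquisingularLiftNatP1VBHomLift
import Literature.AlgebraicGeometry.KTheory.PullbackVectorBundle
import Literature.AlgebraicGeometry.Modules.VectorBundleFiniteLocallyFree
import Literature.AlgebraicGeometry.Modules.SheafHomLeft
import HarnessLib

/-!
# [OURS · L1 W4.5(b) · EL♮(3)] T-P1VB ANY GENUS, brick A: the sub-line-bundle lift theorem of rung v8 DIR₀ (res-type-027's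
# P1VB part 13) over an ARBITRARY proper base `f : X → Spec A` with a two-affine-chart cover, GIVEN the line-bundle lift

Crux chain w45b (cell `res-hironaka`, slot W4.5(b)), working crux **EL♮** = stmt-ResolutionOfSingularities-20038, child **EL♮(3)** =
stmt-ResolutionOfSingularities-20148, route EquisingularLift, line `sections`; supplier of the registered child stub
`stub_elnat_noseTowerResolution` (NOSETOWER closer, res-type-051; CRUX-PLAN v3.11 N2 «ONE NEW BRICK = T-P1VB over an `O`-smooth base curve of
ANY genus»; res-L1-w45b-plan-1 NAMING 2026-08-27T15:58:06Z «res-D-pv-029 ← T-P1VB ANY GENUS»). res-type-027 is credited for T-P1VB parts 1–13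
(p521735 … p538935), of which this file re-assembles the BASE-AGNOSTIC ones. HONEST FRAMING: OURS; NOT a statement of H. Hironaka's manuscript
or of any paper; AI-written kernel lemma, weaker than expert review. No `sorry`; standard axioms; DEF-FREE. `--supports stmt-ResolutionOfSingularities-20148 --as helper`.

WHERE GENUS 0 ENTERED PART 13 (`P1VB.exists_subLineBundle_lift_projectiveLine`, …NatP1VBPackage) — and what this file does instead:
* (G0-1/2) `Pic ℙ¹_k = ℤ` and the explicit lift `𝒪_A(d) = glued_A(a,b)` (…NatP1VBPicProjectiveLine, …NatP1VBLineBundleLift): every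
  line bundle `L₀` on `ℙ¹_k` is `≅ g^*K̃` for an explicit line bundle `K̃` on `ℙ¹_A`, trivial on the two standard charts. HERE the
  lift is an INPUT: a module `K` on `X` with rank-one frames `κ i` on the two charts `U i` and an isomorphism `e : L₀ ≅ g^*K`. Over a
  base curve of positive genus this input is Pic-lifting along the special fibre (`H²(B_k, 𝒪) = 0`, `A` complete; EGA III §7 /
  Illusie, FGA explained §8.5 + Grothendieck existence) — NOT in the tree, hence not hidden here.
* (G0-3) `H¹(ℙ¹_k, 𝒪) = 0` (…NatP1VBCechTransfer) was used to transfer `Ȟ¹(𝓗om(L₀, Q)) = 0` to `Ȟ¹(𝓗om(L₀, g^*F)) = 0`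
  (…NatP1VBHomTransfer). In genus `g ≥ 1` this transfer FAILS (`H¹(B_k, 𝒪) = k^g`), so HERE the Čech hypothesis is stated on
  `𝓗om(L₀, g^*F)` itself (`h1`). HONEST NOTE for the closer: `DirStepUnobs` of …NatDirZeroDefs (= `Ȟ¹(𝓗om(K₀, 𝒞_k/K₀)) = 0`) does
  NOT imply `h1` in positive genus; the statement with only `Ȟ¹(𝓗om(L₀,Q)) = 0` is the deformation theory of the quotient
  [Huybrechts–Lehn, Lemma 2.2.6 / Prop. 2.2.8] plus algebraisation over complete `A`, a different route (brick B, not this file).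
* (G0-4) the two standard charts `D₊(x₀), D₊(x₁)` ↦ ANY cover `U : Fin 2 → X.Opens` by affine opens with affine intersection.

WHAT (namespace `…Cruxes.EquisingularLiftNat.P1VB`):
* `exists_frame_of_chartFrames` — rank-one frames near every point from the two chart frames.
* **`exists_subLineBundle_lift_of_lineBundleLift`** — `A` Noetherian local, `φ : A → B` onto a non-zero ring, `f : X → Spec A` proper,
  `g : Y → X` its base change along `φ` (`IsPullback g t f (Spec φ)`), `X = U₀ ∪ U₁` (affine, affine intersection), `F` a vector bundle on
  `X`, `K` an `𝒪_X`-module free of rank one on `U₀` and on `U₁`, `L₀` on `Y` with `e : L₀ ≅ g^*K` and a LOCALLY SPLIT `ι₀ : L₀ → g^*F`,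
  and `Ȟ¹((g⁻¹U₀, g⁻¹U₁); 𝓗om(L₀, g^*F)) = 0`. THEN there is `σ : K → F` with `g^*σ = e⁻¹ ≫ ι₀` and `σ` locally split (a sub-line-bundle
  of `F` lifting `L₀ ⊆ g^*F`) — the conclusion of part 13 VERBATIM with `glued_A(a,b)` replaced by the given `K`. Proof = part 11
  (`exists_pullback_map_eq`, the Hom-lift: Nakayama on the two-chart Čech complex, finiteness by dévissage) + part 12 (sub-bundle
  transfer `isNowhereVanishing_hom_of_retraction` / `_of_pullback` / `exists_retraction_of_isNowhereVanishing_hom`).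
* `exists_subLineBundle_lift_of_lineBundleLift'` — the same with the Čech hypothesis on `𝓗om(g^*K, g^*F)` (no `e`-transport);
  `exists_subLineBundle_lift_of_exists_lineBundleLift` — part 13's `∃`-shape with the lift given as an existence hypothesis.

References: Hartshorne III.12.11 (degree 0); The Stacks Project, Tags 01ED, 01C6; D. Huybrechts, M. Lehn, *The geometry of moduli spaces
of sheaves*, Lemma 2.2.6–Prop. 2.2.8 (for the honest note); res-type-027's parts 11–13 (p536226, p537043, p538935).
-/

noncomputable section

open CategoryTheory AlgebraicGeometry Limits TopologicalSpace Opposite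
open Literature.AlgebraicGeometry.Modules Literature.AlgebraicGeometry.Morphisms Literature.AlgebraicGeometry

set_option linter.dupNamespace false -- mandated namespace `Summit.<Summit>.<Problem>` of this single-conjunct summit

namespace Summit.ResolutionOfSingularities.ResolutionOfSingularities.Cruxes.EquisingularLiftNat.P1VB

section AnyBase

variable {A B : Type} [CommRing A] [IsNoetherianRing A] [IsLocalRing A] [CommRing B] [Nontrivial B] (φ : A →+* B)
  {X Y : Scheme.{0}} (f : X ⟶ Spec (.of A)) [IsProper f] {g : Y ⟶ X} {t : Y ⟶ Spec (.of B)} (U : Fin 2 → X.Opens)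

/-- Rank-one frames near every point of `X` from rank-one frames on the two charts of a cover. [folklore] -/
theorem exists_frame_of_chartFrames (hcov : ⨆ i, U i = ⊤) (K : X.Modules)
    (κ : ∀ i, SheafOfModules.free (Fin 1) ≅ K.over (U i)) (x : X) :
    ∃ (W : X.Opens) (_ : x ∈ W), Nonempty (SheafOfModules.free (Fin 1) ≅ K.over W) := by
  have hx : x ∈ (⊤ : X.Opens) := trivial
  rw [← hcov] at hx
  obtain ⟨i, hi⟩ := Opens.mem_iSup.mp hx
  exact ⟨U i, hi, ⟨κ i⟩⟩

/-- **T-P1VB ANY BASE — the lift of a sub-line-bundle along the special fibre, GIVEN the line-bundle lift; Čech hypothesis on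
`𝓗om(g^*K, g^*F)`.** See the module docstring. [cite: Hartshorne1977, III.12.11] -/
theorem exists_subLineBundle_lift_of_lineBundleLift' (hφ : Function.Surjective φ)
    (H : IsPullback g t f (Spec.map (CommRingCat.ofHom φ)))
    (hU : ∀ i, IsAffineOpen (U i)) (hU01 : IsAffineOpen (U 0 ⊓ U 1)) (hcov : ⨆ i, U i = ⊤)
    (F : X.Modules) (hF : Motives.IsVectorBundle F)
    (K : X.Modules) (κ : ∀ i, SheafOfModules.free (Fin 1) ≅ K.over (U i))
    (ψ₀ : (Scheme.Modules.pullback g).obj K ⟶ (Scheme.Modules.pullback g).obj F)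
    (hsplit : ∀ y : Y, ∃ (W : Y.Opens) (_ : y ∈ W)
      (r : ((Scheme.Modules.pullback g).obj F).over W ⟶ ((Scheme.Modules.pullback g).obj K).over W),
      (SheafOfModules.overFunctor _ W).map ψ₀ ≫ r = 𝟙 _)
    (h1 : Subsingleton (CechMH1 t (sheafHom ((Scheme.Modules.pullback g).obj K) ((Scheme.Modules.pullback g).obj F))
      (fun i => g ⁻¹ᵁ U i))) :
    ∃ σ : K ⟶ F, (Scheme.Modules.pullback g).map σ = ψ₀ ∧
      ∀ x : X, ∃ (W : X.Opens) (_ : x ∈ W) (r : F.over W ⟶ K.over W),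
        (SheafOfModules.overFunctor _ W).map σ ≫ r = 𝟙 _ := by
  haveI : UniversallyClosed f := IsProper.toUniversallyClosed
  have hFfl : Motives.IsFiniteLocallyFree F := isFiniteLocallyFree_of_isVectorBundle hF
  -- frames of `K` near every point; `K` is finite locally free
  have hKfr := exists_frame_of_chartFrames U hcov K κ
  have hKfl : Motives.IsFiniteLocallyFree K := fun x => by
    obtain ⟨W, hx, ⟨κ'⟩⟩ := hKfr x
    exact ⟨W, hx, Fin 1, inferInstance, ⟨κ'⟩⟩
  -- part 11: the Hom-lift
  obtain ⟨σ, hσ⟩ := exists_pullback_map_eq f K F U κ φ hφ H (coh_of_isVectorBundle hKfl.isVectorBundle)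
    (coh_of_isVectorBundle hF) hU hU01 hcov h1 ψ₀
  refine ⟨σ, hσ, ?_⟩
  -- part 12: `σ` is locally split because `ψ₀ = g^*σ` is
  have hK'fr : ∀ y : Y, ∃ (W : Y.Opens) (_ : y ∈ W),
      Nonempty (SheafOfModules.free (Fin 1) ≅ ((Scheme.Modules.pullback g).obj K).over W) := fun y => by
    obtain ⟨W, hy, ⟨κ'⟩⟩ := hKfr (g.base y)
    exact ⟨g ⁻¹ᵁ W, show y ∈ g ⁻¹ᵁ W from hy, ⟨pullbackFrame g κ'⟩⟩
  have hnv' := isNowhereVanishing_hom_of_retraction hK'fr (hFfl.pullback _) _ hsplit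
  rw [← hσ] at hnv'
  have hnv := isNowhereVanishing_hom_of_pullback φ f hφ H hKfl hFfl σ hnv'
  exact exists_retraction_of_isNowhereVanishing_hom hKfr hFfl σ hnv

/-- **T-P1VB ANY BASE — the lift of a sub-line-bundle `ι₀ : L₀ ↪ g^*F` along the special fibre, GIVEN the line-bundle lift
`e : L₀ ≅ g^*K`; Čech hypothesis on `𝓗om(L₀, g^*F)`** (part 13's conclusion currency: `g^*σ = e⁻¹ ≫ ι₀`, `σ` locally split).
See the module docstring for what the consumer must supply in positive genus. [cite: Hartshorne1977, III.12.11] -/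
theorem exists_subLineBundle_lift_of_lineBundleLift (hφ : Function.Surjective φ)
    (H : IsPullback g t f (Spec.map (CommRingCat.ofHom φ)))
    (hU : ∀ i, IsAffineOpen (U i)) (hU01 : IsAffineOpen (U 0 ⊓ U 1)) (hcov : ⨆ i, U i = ⊤)
    (F : X.Modules) (hF : Motives.IsVectorBundle F)
    (K : X.Modules) (κ : ∀ i, SheafOfModules.free (Fin 1) ≅ K.over (U i))
    (L₀ : Y.Modules) (ι₀ : L₀ ⟶ (Scheme.Modules.pullback g).obj F)
    (e : L₀ ≅ (Scheme.Modules.pullback g).obj K)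
    (hsplit : ∀ y : Y, ∃ (W : Y.Opens) (_ : y ∈ W) (r : ((Scheme.Modules.pullback g).obj F).over W ⟶ L₀.over W),
      (SheafOfModules.overFunctor _ W).map ι₀ ≫ r = 𝟙 _)
    (h1 : Subsingleton (CechMH1 t (sheafHom L₀ ((Scheme.Modules.pullback g).obj F)) (fun i => g ⁻¹ᵁ U i))) :
    ∃ σ : K ⟶ F, (Scheme.Modules.pullback g).map σ = e.inv ≫ ι₀ ∧
      ∀ x : X, ∃ (W : X.Opens) (_ : x ∈ W) (r : F.over W ⟶ K.over W),
        (SheafOfModules.overFunctor _ W).map σ ≫ r = 𝟙 _ := by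
  -- transport the Čech hypothesis and the local splittings along `e`
  have h1' := subsingleton_cechMH1_sheafHom_of_iso t (fun i => g ⁻¹ᵁ U i) e ((Scheme.Modules.pullback g).obj F) h1
  have hsplit' : ∀ y : Y, ∃ (W : Y.Opens) (_ : y ∈ W)
      (r : ((Scheme.Modules.pullback g).obj F).over W ⟶ ((Scheme.Modules.pullback g).obj K).over W),
      (SheafOfModules.overFunctor Y.ringCatSheaf W).map (e.inv ≫ ι₀) ≫ r = 𝟙 _ := fun y => by
    obtain ⟨W, hy, r, hr⟩ := hsplit y
    refine ⟨W, hy, r ≫ (SheafOfModules.overFunctor Y.ringCatSheaf W).map e.hom, ?_⟩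
    have hre : (SheafOfModules.overFunctor Y.ringCatSheaf W).map (e.inv ≫ ι₀) ≫
        r ≫ (SheafOfModules.overFunctor Y.ringCatSheaf W).map e.hom =
        (SheafOfModules.overFunctor Y.ringCatSheaf W).map e.inv ≫
          ((SheafOfModules.overFunctor Y.ringCatSheaf W).map ι₀ ≫ r) ≫
            (SheafOfModules.overFunctor Y.ringCatSheaf W).map e.hom := by
      rw [CategoryTheory.Functor.map_comp]
      simp only [Category.assoc]
    rw [hre, hr, Category.id_comp]
    exact ((SheafOfModules.overFunctor Y.ringCatSheaf W).mapIso e).inv_hom_id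
  exact exists_subLineBundle_lift_of_lineBundleLift' φ f U hφ H hU hU01 hcov F hF K κ (e.inv ≫ ι₀) hsplit' h1'

/-- **T-P1VB ANY BASE, packaged in part 13's `∃`-shape**: with the line-bundle lift given only as an EXISTENCE statement
(`hlift : ∃ K, (frames on the two charts) ∧ L₀ ≅ g^*K` — over a base curve of positive genus this is Pic-lifting along the special
fibre, to be cited by the consumer), the conclusion reads `∃ K σ e, g^*σ = e⁻¹ ≫ ι₀ ∧ σ locally split`, i.e. part 13's
`∃ a b σ e, …` with `glued_A(a,b)` replaced by the abstract lift `K`. [cite: Hartshorne1977, III.12.11] -/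
theorem exists_subLineBundle_lift_of_exists_lineBundleLift (hφ : Function.Surjective φ)
    (H : IsPullback g t f (Spec.map (CommRingCat.ofHom φ)))
    (hU : ∀ i, IsAffineOpen (U i)) (hU01 : IsAffineOpen (U 0 ⊓ U 1)) (hcov : ⨆ i, U i = ⊤)
    (F : X.Modules) (hF : Motives.IsVectorBundle F)
    (L₀ : Y.Modules) (ι₀ : L₀ ⟶ (Scheme.Modules.pullback g).obj F)
    (hsplit : ∀ y : Y, ∃ (W : Y.Opens) (_ : y ∈ W) (r : ((Scheme.Modules.pullback g).obj F).over W ⟶ L₀.over W),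
      (SheafOfModules.overFunctor _ W).map ι₀ ≫ r = 𝟙 _)
    (h1 : Subsingleton (CechMH1 t (sheafHom L₀ ((Scheme.Modules.pullback g).obj F)) (fun i => g ⁻¹ᵁ U i)))
    (hlift : ∃ K : X.Modules, (∀ i, Nonempty (SheafOfModules.free (Fin 1) ≅ K.over (U i))) ∧
      Nonempty (L₀ ≅ (Scheme.Modules.pullback g).obj K)) :
    ∃ (K : X.Modules) (σ : K ⟶ F) (e : L₀ ≅ (Scheme.Modules.pullback g).obj K),
      (Scheme.Modules.pullback g).map σ = e.inv ≫ ι₀ ∧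
      ∀ x : X, ∃ (W : X.Opens) (_ : x ∈ W) (r : F.over W ⟶ K.over W),
        (SheafOfModules.overFunctor _ W).map σ ≫ r = 𝟙 _ := by
  obtain ⟨K, hK, ⟨e⟩⟩ := hlift
  obtain ⟨σ, hσ, hspl⟩ := exists_subLineBundle_lift_of_lineBundleLift φ f U hφ H hU hU01 hcov F hF K (fun i => (hK i).some) L₀
    ι₀ e hsplit h1
  exact ⟨K, σ, e, hσ, hspl⟩

end AnyBase

end Summit.ResolutionOfSingularities.ResolutionOfSingularities.Cruxes.EquisingularLiftNat.P1VB

end
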